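import Literature.AlgebraicGeometry.Modules.DetClassOfIso
import HarnessLib

/-!
# Indexed rank-one frame systems (trivialisations of a line bundle on a family of opens) and their transition functions

`IFrames M W`: trivialisations `𝒪 ≅ M|_{W a}` of a module `M` on an indexed family of opens `W : ι → Y.Opens` (no covering
condition); the transition functions `tf a b ∈ Γ(W a ⊓ W b)` (units, cocycle identity — [GortzWedhorn2020] Prop. 11.15 /
Remark 11.16, (11.6)), change of frames `chg` of two frame systems of one module, transport along an isomorphism of modules
(`mapIso`, same transition functions), pull-back along a morphism of schemes (`pullback`, `tf_pullback`), casting along an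
equality of open families, and GLUING: two modules framed on a covering family whose transition functions are related by a
unit `0`-cochain are isomorphic (`nonempty_iso_of_rel`, [Hartshorne1977] III Ex. 4.5).  Built on the tree's
`Modules/DetClassOfIso` (`transitionDet`, `pullbackFrame`).
HC_CM is proved only modulo the 7 printed citations until rung 0 closes.

## References
* [GortzWedhorn2020] U. Görtz, T. Wedhorn, *Algebraic Geometry I*, 2nd ed., Prop. 11.15 and Remark 11.16, (11.6).
* [Hartshorne1977] R. Hartshorne, *Algebraic Geometry*, II.5 (p. 110), III Ex. 4.5.
-/

noncomputable section

universe u v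

open CategoryTheory AlgebraicGeometry

namespace Literature.AlgebraicGeometry.Modules

open Literature.AlgebraicGeometry.Motives Opposite TopologicalSpace

/-- The enumeration of the one-element index type. [folklore] -/
def punitEnum : (PUnit : Type u) ≃ Fin 1 := Equiv.ofUnique _ _

variable {Y : Scheme.{u}} {ι : Type v}

/-- **An indexed rank-one frame system**: trivialisations `𝒪 ≅ M|_{W a}` on a family of opens.
[cite: GortzWedhorn2020, Prop. 11.15 and Remark 11.16] -/
structure IFrames (M : Y.Modules) (W : ι → Y.Opens) where
  /-- the frame on `W a` -/
  frame : ∀ a, SheafOfModules.free (PUnit : Type u) ≅ M.over (W a)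

namespace IFrames

variable {M M' : Y.Modules} {W : ι → Y.Opens}

/-! ### Transition functions -/

/-- **The transition function** `tf a b = det T(e_a, e_b) ∈ Γ(Y, W a ⊓ W b)` (`e_b = tf a b · e_a` on the
overlap). [cite: Hartshorne1977, II Ex. 5.16] -/
def tf (F : IFrames M W) (a b : ι) : Γ(Y, W a ⊓ W b) :=
  transitionDet (F.frame a) (F.frame b) punitEnum punitEnum (homOfLE inf_le_left) (homOfLE inf_le_right)

/-- The transition function over any open below `W a ⊓ W b`. [folklore] -/
def tfOn (F : IFrames M W) (a b : ι) (V : Y.Opens) (ha : V ≤ W a) (hb : V ≤ W b) : Γ(Y, V) :=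
  transitionDet (F.frame a) (F.frame b) punitEnum punitEnum (homOfLE ha) (homOfLE hb)

/-- `tf` is `tfOn` over the overlap. [cite: GortzWedhorn2020, Prop. 11.15 and Remark 11.16] -/
theorem tf_eq_tfOn (F : IFrames M W) (a b : ι) : F.tf a b = F.tfOn a b (W a ⊓ W b) inf_le_left inf_le_right := rfl

/-- `tfOn` is compatible with restriction. [cite: GortzWedhorn2020, Prop. 11.15 and Remark 11.16] -/
theorem map_tfOn (F : IFrames M W) (a b : ι) {V V' : Y.Opens} (ha : V ≤ W a) (hb : V ≤ W b) (i : V' ≤ V) :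
    Y.presheaf.map (homOfLE i).op (F.tfOn a b V ha hb) = F.tfOn a b V' (i.trans ha) (i.trans hb) := by
  unfold tfOn
  rw [transitionDet_map]
  exact transitionDet_congr_hom _ _ _ _ _ _ _ _

/-- Restricting `tf` gives `tfOn`. [cite: GortzWedhorn2020, Prop. 11.15 and Remark 11.16] -/
theorem map_tf (F : IFrames M W) (a b : ι) {V : Y.Opens} (i : V ≤ W a ⊓ W b) :
    Y.presheaf.map (homOfLE i).op (F.tf a b) = F.tfOn a b V (i.trans inf_le_left) (i.trans inf_le_right) :=
  F.map_tfOn a b inf_le_left inf_le_right i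

/-- **The cocycle identity** `tf a b| · tf b c| = tf a c|` over any open below the three. [cite: Hartshorne1977, II Ex. 5.16] -/
theorem tfOn_mul (F : IFrames M W) (a b c : ι) (V : Y.Opens) (ha : V ≤ W a) (hb : V ≤ W b) (hc : V ≤ W c) :
    F.tfOn a b V ha hb * F.tfOn b c V hb hc = F.tfOn a c V ha hc :=
  transitionDet_mul _ _ _ _ _ _ _ _ _

/-- `tfOn a a = 1`. [cite: GortzWedhorn2020, Prop. 11.15 and Remark 11.16] -/
@[simp] theorem tfOn_self (F : IFrames M W) (a : ι) (V : Y.Opens) (ha : V ≤ W a) : F.tfOn a a V ha ha = 1 :=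
  transitionDet_self _ _ _

/-- The transition functions are units. [cite: GortzWedhorn2020, Prop. 11.15 and Remark 11.16] -/
theorem isUnit_tfOn (F : IFrames M W) (a b : ι) (V : Y.Opens) (ha : V ≤ W a) (hb : V ≤ W b) :
    IsUnit (F.tfOn a b V ha hb) :=
  isUnit_transitionDet _ _ _ _ _ _

/-- The transition functions are units. [cite: GortzWedhorn2020, Prop. 11.15 and Remark 11.16] -/
theorem isUnit_tf (F : IFrames M W) (a b : ι) : IsUnit (F.tf a b) := F.isUnit_tfOn a b _ _ _

/-- The cocycle identity on the triple overlap, in the shape of `Morphisms.cechD1`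
(`U_{abc} = W a ⊓ W b ⊓ W c`). [cite: Hartshorne1977, II Ex. 5.16] -/
theorem tf_cocycle (F : IFrames M W) (a b c : ι) :
    Y.presheaf.map (homOfLE (inf_le_left : W a ⊓ W b ⊓ W c ≤ W a ⊓ W b)).op (F.tf a b) *
      Y.presheaf.map (homOfLE (le_inf (inf_le_left.trans inf_le_right) inf_le_right : W a ⊓ W b ⊓ W c ≤ W b ⊓ W c)).op
        (F.tf b c) =
      Y.presheaf.map (homOfLE (le_inf (inf_le_left.trans inf_le_left) inf_le_right : W a ⊓ W b ⊓ W c ≤ W a ⊓ W c)).op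
        (F.tf a c) := by
  rw [map_tf, map_tf, map_tf]
  exact F.tfOn_mul a b c _ _ _ _

/-! ### Change of frames: two frame systems of the same module -/

/-- **The change-of-frames units** `chg F F' a = det T(e'_a, e_a) ∈ Γ(Y, W a)` (`e_a = chg a · e'_a`). [folklore] -/
def chg (F F' : IFrames M W) (a : ι) : Γ(Y, W a) :=
  transitionDet (F'.frame a) (F.frame a) punitEnum punitEnum (homOfLE le_rfl) (homOfLE le_rfl)

/-- The change-of-frames functions are units. [cite: GortzWedhorn2020, Prop. 11.15 and Remark 11.16] -/
theorem isUnit_chg (F F' : IFrames M W) (a : ι) : IsUnit (F.chg F' a) := isUnit_transitionDet _ _ _ _ _ _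

/-- **Two frame systems of the same module have related transition functions**:
`chg a| · F.tf a b = F'.tf a b · chg b|` on `W a ⊓ W b`. [cite: GortzWedhorn2020, Prop. 11.15] -/
theorem chg_rel (F F' : IFrames M W) (a b : ι) :
    Y.presheaf.map (homOfLE (inf_le_left : W a ⊓ W b ≤ W a)).op (F.chg F' a) * F.tf a b =
      F'.tf a b * Y.presheaf.map (homOfLE (inf_le_right : W a ⊓ W b ≤ W b)).op (F.chg F' b) := by
  unfold chg tf
  rw [transitionDet_map, transitionDet_map]
  rw [transitionDet_congr_hom (F'.frame a) (F.frame a) punitEnum punitEnum _ (homOfLE inf_le_left) _ (homOfLE inf_le_left),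
    transitionDet_congr_hom (F'.frame b) (F.frame b) punitEnum punitEnum _ (homOfLE inf_le_right) _ (homOfLE inf_le_right),
    transitionDet_mul, ← transitionDet_mul (F'.frame a) (F'.frame b) (F.frame b) punitEnum punitEnum punitEnum
      (homOfLE inf_le_left) (homOfLE inf_le_right) (homOfLE inf_le_right)]

/-! ### Transport along an isomorphism of modules -/

/-- **Transport of frames along `ψ : M ≅ M'`.** [folklore] -/
def mapIso (F : IFrames M W) (ψ : M ≅ M') : IFrames M' W where
  frame a := F.frame a ≪≫ (SheafOfModules.overFunctor _ (W a)).mapIso ψ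

/-- **Transported frames have the same transition functions.** [cite: GortzWedhorn2020, Prop. 11.15 and Rem. 11.16] -/
@[simp] theorem tfOn_mapIso (F : IFrames M W) (ψ : M ≅ M') (a b : ι) (V : Y.Opens) (ha : V ≤ W a) (hb : V ≤ W b) :
    (F.mapIso ψ).tfOn a b V ha hb = F.tfOn a b V ha hb :=
  transitionDet_trans_mapIso ψ _ _ _ _ _ _

/-- **Transported frames have the same transition functions.** [cite: GortzWedhorn2020, Prop. 11.15 and Remark 11.16] -/
@[simp] theorem tf_mapIso (F : IFrames M W) (ψ : M ≅ M') (a b : ι) : (F.mapIso ψ).tf a b = F.tf a b :=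
  F.tfOn_mapIso ψ a b _ _ _

/-! ### Pull-back along a morphism of schemes -/

/-- **Pull-back of frames along `g : Y' ⟶ Y`** (frames of `g^*M` on `g⁻¹(W a)`). [cite: Hartshorne1977, II.5 (p. 110)] -/
def pullback {Y' : Scheme.{u}} (F : IFrames M W) (g : Y' ⟶ Y) :
    IFrames ((Scheme.Modules.pullback g).obj M) (fun a => g ⁻¹ᵁ W a) where
  frame a := pullbackFrame g (F.frame a)

/-- **The transition functions of the pulled-back frames are the pulled-back transition functions.** [cite: GortzWedhorn2020, Prop. 11.15 and Remark 11.16] -/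
theorem tf_pullback {Y' : Scheme.{u}} (F : IFrames M W) (g : Y' ⟶ Y) (a b : ι) :
    (F.pullback g).tf a b = g.appLE (W a ⊓ W b) (g ⁻¹ᵁ W a ⊓ g ⁻¹ᵁ W b) (by rw [← Scheme.Hom.preimage_inf]) (F.tf a b) :=
  transitionDet_pullbackFrame g (F.frame a) (F.frame b) punitEnum punitEnum _ _ _

/-! ### Gluing an isomorphism from related transition functions -/

section Glue

variable (F : IFrames M W) (F' : IFrames M' W) (hW : iSup W = ⊤)

/-- A choice of index `a x` with `x ∈ W (a x)` for a covering family. [cite: GortzWedhorn2020, Prop. 11.15 and Remark 11.16] -/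
theorem exists_index (hW : iSup W = ⊤) (x : Y) : ∃ a, x ∈ W a := by
  have : x ∈ (iSup W : Y.Opens) := by rw [hW]; trivial
  exact Opens.mem_iSup.mp this

/-- The point-indexed frame system `x ↦ e_{a(x)}` of an indexed frame system on a covering family. [folklore] -/
def toFrameSystem (hW : iSup W = ⊤) : FrameSystem M where
  U x := W (exists_index hW x).choose
  mem x := (exists_index hW x).choose_spec
  I _ := PUnit
  rank _ := 1
  enum _ := punitEnum
  frame x := F.frame (exists_index hW x).choose

/-- The transition functions of `toFrameSystem` are the `tfOn` of the chosen indices. [cite: GortzWedhorn2020, Prop. 11.15 and Remark 11.16] -/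
theorem toFrameSystem_cocycle_g (x y : Y) (V : Y.Opens) (hx : V ≤ (F.toFrameSystem hW).U x)
    (hy : V ≤ (F.toFrameSystem hW).U y) :
    (F.toFrameSystem hW).cocycle.g x y V hx hy =
      F.tfOn (exists_index hW x).choose (exists_index hW y).choose V hx hy := rfl

include hW in
/-- **GLUING: frame systems of `M`, `M'` on the same covering family whose transition functions are related by
units `h a ∈ Γ(Y, W a)` (`F'.tf a b · h b| = h a| · F.tf a b`) give `M ≅ M'`** (injectivity of
`Pic Y → Ȟ¹(Y, 𝒪_Y^×)`; ★ `nonempty_iso_of_cocycle_equiv`). [cite: Hartshorne1977, III Ex. 4.5] -/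
theorem nonempty_iso_of_rel (h : ∀ a, Γ(Y, W a)) (hh : ∀ a, IsUnit (h a))
    (hrel : ∀ a b, F'.tf a b * Y.presheaf.map (homOfLE (inf_le_right : W a ⊓ W b ≤ W b)).op (h b) =
      Y.presheaf.map (homOfLE (inf_le_left : W a ⊓ W b ≤ W a)).op (h a) * F.tf a b) :
    Nonempty (M ≅ M') := by
  classical
  refine nonempty_iso_of_cocycle_equiv (F.toFrameSystem hW) (F'.toFrameSystem hW) (fun _ => rfl) (fun _ => rfl)
    (CechPic.sound ⟨?_⟩)
  -- the coboundary `x ↦ h (a x)` on `W (a x)`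
  refine
    { W := fun x => W (exists_index hW x).choose
      mem := fun x => (exists_index hW x).choose_spec
      le := fun x => le_rfl
      le' := fun x => le_rfl
      lam := fun x V hV => Y.presheaf.map (homOfLE hV).op (h _)
      inv := fun x V hV => Y.presheaf.map (homOfLE hV).op (((hh (exists_index hW x).choose).unit⁻¹ : (Γ(Y, W (exists_index hW x).choose))ˣ) : Γ(Y, W (exists_index hW x).choose))
      map_lam := fun x V V' hV i => ?_
      lam_mul_inv := fun x V hV => ?_
      rel := fun x y V hx hy => ?_ }
  · change (Y.presheaf.map (homOfLE hV).op ≫ Y.presheaf.map (homOfLE i).op) (h _) = _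
    rw [← Y.presheaf.map_comp]; rfl
  · rw [← map_mul, IsUnit.mul_val_inv, map_one]
  · -- restrict `hrel` to `V ≤ W (a x) ⊓ W (a y)`
    set a := (exists_index hW x).choose
    set b := (exists_index hW y).choose
    have hV : V ≤ W a ⊓ W b := le_inf hx hy
    have := congrArg (Y.presheaf.map (homOfLE hV).op) (hrel a b)
    simp only [map_mul] at this
    rw [map_tf, map_tf] at this
    have e1 : Y.presheaf.map (homOfLE hV).op (Y.presheaf.map (homOfLE (inf_le_right : W a ⊓ W b ≤ W b)).op (h b)) =
        Y.presheaf.map (homOfLE hy).op (h b) := by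
      change (Y.presheaf.map _ ≫ Y.presheaf.map _) _ = _
      rw [← Y.presheaf.map_comp]; rfl
    have e2 : Y.presheaf.map (homOfLE hV).op (Y.presheaf.map (homOfLE (inf_le_left : W a ⊓ W b ≤ W a)).op (h a)) =
        Y.presheaf.map (homOfLE hx).op (h a) := by
      change (Y.presheaf.map _ ≫ Y.presheaf.map _) _ = _
      rw [← Y.presheaf.map_comp]; rfl
    rw [e1, e2] at this
    rw [toFrameSystem_cocycle_g, toFrameSystem_cocycle_g]
    exact this

end Glue

/-! ### Casting indexed frames along an equality of open families -/

/-- Frames on `W` are frames on `W'` when `W = W'`. [folklore] -/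
def cast {M : Y.Modules} {W W' : ι → Y.Opens}
    (F : IFrames M W) (e : W = W') : IFrames M W' := e ▸ F

/-- Casting does not change the transition functions (up to the cast of sections). [cite: GortzWedhorn2020, Prop. 11.15 and Remark 11.16] -/
theorem tf_cast {M : Y.Modules} {W W' : ι → Y.Opens}
    (F : IFrames M W) (e : W = W') (a b : ι) :
    (F.cast e).tf a b = Y.presheaf.map (eqToHom (by rw [e])).op (F.tf a b) := by
  subst e
  rw [eqToHom_refl, op_id, Y.presheaf.map_id]
  rfl

end IFrames

end Literature.AlgebraicGeometry.Modules

end
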